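import Summits.CriticalPhenomena.PercolationContinuityZ3.Theorems.PercNearOneGluingNoHeavyLowerTailKNConj4OfCSH
import HarnessLib

/-!
# `NoHeavyLowerTail` (stmt-CriticalPhenomena-4575), line fat-minority-linear — the EVENT-REFINED pre-FKG inequality
# (Conjecture 4 / Question 7 conditioned on an arbitrary increasing cluster event) reduced to ONE two-observer margin

Support file (`--supports stmt-CriticalPhenomena-4575`), route task `nh-dp-fatminority` (gen 13).  No definitions, no named facts,
no sorries; standard axioms.  Companion memo: `run/shared/lean/prim/prim-nh-dp-fatminority/FINDINGS-fat-minority-gen13.md` §5.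

The tree's `PreFKGSurplus.kn_conj4_of_csh` (prim-ineq-gen-6) proves Kozma–Nitzan's Conjecture 4 in designated form,
`∫_{o↔A} F(C c) ≤ ∫_{o↔A} F(C o)` for `c ∈ A` of least mean, from the conditioned slack hierarchy.  The single-star
inequalities of this line (UT4 / QUT4 for arbitrary up-sets of the observer's edges, QS/QS⁺) and their general-observer
form are the REFINEMENT in which the conditioning event `{o ↔ A}` is replaced by `{C o ∈ 𝓗} ∩ {o ↔ A}` for an upper family
`𝓗` of vertex sets (an increasing event of the cluster of `o`).  This file runs the tree's assembly with the event carried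
along and isolates what is missing:

* `RefinedPreFKG.refined_erase_add` — peeling a relay `k` under the event: on the peeled piece `C o = C k`, so the event is
  read on `C k`;
* `RefinedPreFKG.conj4_refined_of_twoObserver` — **the refined Conjecture 4 for EVERY relay set follows from the two-observer
  inequality (II)_𝓗**: `μ(D_k ∩ {k↔o} ∩ {C k ∈ 𝓗}) · Δ_k(X') ≤ μ(D_k) · Δ^𝓗_o(X')` (`D_k = {k ↮ X'}`, `Δ_k` the PLAIN margin of
  the observer `k`, `Δ^𝓗_o` the event-refined margin of `o`), by the same three steps as the tree's assembly — peel, tower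
  (`CovTau.setIntegral_sub_eq_projFun`), vdBHK positive association for `C k` given `k ↮ X'` with the MONOTONE indicator
  `1{k↔o}·1{C k ∈ 𝓗}` — the event never meets the projected functional, so no new monotonicity is needed at this level.
  With `𝓗 = univ` the hypothesis is `PreFKGSurplus.preMargin_nonneg_of_csh` at `D = []` and the conclusion is `kn_conj4_of_csh`.
* `RefinedPreFKG.question7_refined_of_twoObserver` — the case `F = 1{b ∈ ·}`: `μ({c↔b} ∩ E) ≤ μ({o↔b} ∩ E)` for
  `E = {C o ∈ 𝓗} ∩ {o↔A}` and `c ∈ A` a-priori least `b`-reliable (Question 7 refined by the event).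
Whether (II)_𝓗 follows from the hierarchy (`CSHHolds` with the first observer replaced by the increasing `C_x`-event
`1{x↔o}·1{C x ∈ 𝓗}`) is the open point handed to the CSH seats; exact enumeration finds no violation (memo §5).
[cite: KozmaNitzan2024, Conj. 4 (p. 32), Question 7 (p. 36)] [cite: VandenbergHaggstromKahn2005, Thm. 1.3 (p. 6), §2.1 Lemma 2.4 (p. 10)]
-/

noncomputable section
namespace Summit.CriticalPhenomena.PercolationContinuityZ3.Theorems
open MeasureTheory Set Literature.Probability.LatticeModels Literature.Probability.Percolation
open scoped Classical
open KNPreFKG CSH PreFKGSurplus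

namespace RefinedPreFKG
variable {n : ℕ}
/-- The open cluster of `k` is the vertex span of its open edge cluster. [folklore] -/
theorem openCluster_eq_span (ω : BondConfig (Fin n)) (k : Fin n) :
    openCluster ω k = {z | z = k ∨ ∃ e ∈ openEdgeCluster ω k, z ∈ e} := by
  ext z
  exact reachable_iff_exists_mem_openEdgeCluster ω k z

/-- **Peeling a relay under the event.**  For `k ∈ X`, an upper family `𝓗` read on the cluster of the observer, and every `u`:
`∫_{{C u ∈ 𝓗} ∩ {u↔X}} (F(C u) − F(C c)) = ∫_{{C u ∈ 𝓗} ∩ {u↔X∖k}} (F(C u) − F(C c)) + ∫_{{k↮X∖k} ∩ {k↔u} ∩ {C k ∈ 𝓗}} (F(C k) − F(C c))`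
(on the new part `C u = C k`). [cite: KozmaNitzan2024, Conj. 4 (p. 32)] -/
theorem refined_erase_add (w : Sym2 (Fin n) → unitInterval) (X : Finset (Fin n)) (F : Set (Fin n) → ℝ)
    (𝓗 : Set (Set (Fin n))) (c k u : Fin n) (hkX : k ∈ X) :
    ∫ ω in {ω : BondConfig (Fin n) | openCluster ω u ∈ 𝓗} ∩ ⋃ a ∈ X, openConn u a,
        (F (openCluster ω u) - F (openCluster ω c)) ∂(prodBernoulli w) =
      (∫ ω in {ω : BondConfig (Fin n) | openCluster ω u ∈ 𝓗} ∩ ⋃ a ∈ X.erase k, openConn u a,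
          (F (openCluster ω u) - F (openCluster ω c)) ∂(prodBernoulli w)) +
        ∫ ω in ({ω : BondConfig (Fin n) | ∀ a ∈ (↑(X.erase k) : Set (Fin n)), ¬ (openGraph ω).Reachable k a} ∩ openConn k u) ∩
            {ω : BondConfig (Fin n) | openCluster ω k ∈ 𝓗},
          (F (openCluster ω k) - F (openCluster ω c)) ∂(prodBernoulli w) := by
  classical
  have hmeas : ∀ S : Set (BondConfig (Fin n)), MeasurableSet S := fun _ => MeasurableSet.of_discrete
  have hint : ∀ (g : BondConfig (Fin n) → ℝ), Integrable g (prodBernoulli w) := fun g => Integrable.of_finite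
  set gu : BondConfig (Fin n) → ℝ := fun ω => F (openCluster ω u) - F (openCluster ω c) with hgu
  set gk : BondConfig (Fin n) → ℝ := fun ω => F (openCluster ω k) - F (openCluster ω c) with hgk
  set Hu : Set (BondConfig (Fin n)) := {ω : BondConfig (Fin n) | openCluster ω u ∈ 𝓗} with hHu
  set Hk : Set (BondConfig (Fin n)) := {ω : BondConfig (Fin n) | openCluster ω k ∈ 𝓗} with hHk
  set Dk : Set (BondConfig (Fin n)) := {ω : BondConfig (Fin n) | ∀ a ∈ (↑(X.erase k) : Set (Fin n)), ¬ (openGraph ω).Reachable k a}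
    with hDk
  have hpt : ∀ ω : BondConfig (Fin n), (Hu ∩ ⋃ a ∈ X, (openConn u a : Set (BondConfig (Fin n)))).indicator gu ω =
      (Hu ∩ ⋃ a ∈ X.erase k, (openConn u a : Set (BondConfig (Fin n)))).indicator gu ω +
        ((Dk ∩ openConn k u) ∩ Hk).indicator gk ω := by
    intro ω
    by_cases hH : ω ∈ Hu
    · by_cases h1 : ∃ a ∈ X.erase k, (openGraph ω).Reachable u a
      · obtain ⟨a, ha, hua⟩ := h1
        have m1 : ω ∈ Hu ∩ ⋃ a ∈ X, (openConn u a : Set (BondConfig (Fin n))) :=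
          ⟨hH, (mem_iUnion_openConn X u ω).2 ⟨a, Finset.mem_of_mem_erase ha, hua⟩⟩
        have m2 : ω ∈ Hu ∩ ⋃ a ∈ X.erase k, (openConn u a : Set (BondConfig (Fin n))) :=
          ⟨hH, (mem_iUnion_openConn _ u ω).2 ⟨a, ha, hua⟩⟩
        have m3 : ω ∉ (Dk ∩ openConn k u) ∩ Hk := fun h =>
          h.1.1 a (Finset.mem_coe.2 ha) ((show (openGraph ω).Reachable k u from h.1.2).trans hua)
        rw [indicator_of_mem m1, indicator_of_mem m2, indicator_of_notMem m3, add_zero]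
      · by_cases h2 : (openGraph ω).Reachable u k
        · have m1 : ω ∈ Hu ∩ ⋃ a ∈ X, (openConn u a : Set (BondConfig (Fin n))) :=
            ⟨hH, (mem_iUnion_openConn X u ω).2 ⟨k, hkX, h2⟩⟩
          have m2 : ω ∉ Hu ∩ ⋃ a ∈ X.erase k, (openConn u a : Set (BondConfig (Fin n))) := fun h =>
            h1 ((mem_iUnion_openConn _ u ω).1 h.2)
          have hCeq : openCluster ω u = openCluster ω k := openCluster_eq_of_reach h2
          have m3 : ω ∈ (Dk ∩ openConn k u) ∩ Hk := by
            refine ⟨⟨fun a ha hka => h1 ⟨a, Finset.mem_coe.1 ha, h2.trans hka⟩, ?_⟩, ?_⟩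
            · exact (show (openGraph ω).Reachable k u from h2.symm)
            · show openCluster ω k ∈ 𝓗
              rw [← hCeq]; exact hH
          rw [indicator_of_mem m1, indicator_of_notMem m2, indicator_of_mem m3, zero_add, hgu, hgk]
          simp only [hCeq]
        · have m1 : ω ∉ Hu ∩ ⋃ a ∈ X, (openConn u a : Set (BondConfig (Fin n))) := by
            intro h
            obtain ⟨a, ha, hua⟩ := (mem_iUnion_openConn X u ω).1 h.2
            by_cases hak : a = k
            · exact h2 (hak ▸ hua)
            · exact h1 ⟨a, Finset.mem_erase.2 ⟨hak, ha⟩, hua⟩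
          have m2 : ω ∉ Hu ∩ ⋃ a ∈ X.erase k, (openConn u a : Set (BondConfig (Fin n))) := fun h =>
            h1 ((mem_iUnion_openConn _ u ω).1 h.2)
          have m3 : ω ∉ (Dk ∩ openConn k u) ∩ Hk := fun h => h2 (show (openGraph ω).Reachable k u from h.1.2).symm
          rw [indicator_of_notMem m1, indicator_of_notMem m2, indicator_of_notMem m3, add_zero]
    · have m1 : ω ∉ Hu ∩ ⋃ a ∈ X, (openConn u a : Set (BondConfig (Fin n))) := fun h => hH h.1
      have m2 : ω ∉ Hu ∩ ⋃ a ∈ X.erase k, (openConn u a : Set (BondConfig (Fin n))) := fun h => hH h.1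
      have m3 : ω ∉ (Dk ∩ openConn k u) ∩ Hk := by
        intro h
        have h2 : (openGraph ω).Reachable u k := (show (openGraph ω).Reachable k u from h.1.2).symm
        have hCeq : openCluster ω u = openCluster ω k := openCluster_eq_of_reach h2
        apply hH
        show openCluster ω u ∈ 𝓗
        rw [hCeq]; exact h.2
      rw [indicator_of_notMem m1, indicator_of_notMem m2, indicator_of_notMem m3, add_zero]
  rw [← integral_indicator (hmeas _), ← integral_indicator (hmeas _), ← integral_indicator (hmeas _),
    ← integral_add (hint _) (hint _)]
  exact integral_congr_ae (Filter.Eventually.of_forall hpt)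

/-- **The event-refined pre-FKG margin is nonnegative, given the two-observer inequality (II)_𝓗.**  Non-degenerate weights;
`𝓗` an upper family of vertex sets (the increasing cluster event `{C o ∈ 𝓗}` refining `{o ↔ A}`); `F` monotone; `o ∉ A`; `c ∈ A` of
least mean.  HYPOTHESIS `hII` (the refined two-observer margin): for observers `o' ≠ k`, a relay set `X' ∌ o', k` with `c' ∈ X'` of
least mean over `X' ∪ {k}`:
`μ({k↮X'} ∩ {k↔o'} ∩ {C k ∈ 𝓗}) · ∫_{k↔X'} (F(C k) − F(C c')) ≤ μ({k↮X'}) · ∫_{{C o' ∈ 𝓗} ∩ {o'↔X'}} (F(C o') − F(C c'))`.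
CONCLUSION: `0 ≤ ∫_{{C o ∈ 𝓗} ∩ {o↔A}} (F(C o) − F(C c))`.  Proof = the tree's assembly `PreFKGSurplus.kn_conj4_of_csh` with the event
carried along: peel a relay `k ≠ c` (`refined_erase_add`), tower along `σ(C k)` (`CovTau.setIntegral_sub_eq_projFun`), vdBHK positive
association for `C k` given `k ↮ A∖k` with the monotone indicator `1{k↔o}·1{C k ∈ 𝓗}`, and `hII` in place of the plain two-observer margin.
[cite: KozmaNitzan2024, Conj. 4 (p. 32)] [cite: VandenbergHaggstromKahn2005, Thm. 1.3 (p. 6), §2.1 Lemma 2.4 (p. 10)] -/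
theorem refined_margin_nonneg_of_twoObserver (w : Sym2 (Fin n) → unitInterval) (hw : ∀ e, 0 < w e ∧ w e < 1)
    (𝓗 : Set (Set (Fin n))) (h𝓗 : IsUpperSet 𝓗)
    (F : Set (Fin n) → ℝ) (hF : ∀ S T : Set (Fin n), S ⊆ T → F S ≤ F T)
    (hII : ∀ (o k c : Fin n) (X' : Finset (Fin n)), o ≠ k → o ∉ X' → k ∉ X' → c ∈ X' →
      (∀ a ∈ X', ∫ ω, F (openCluster ω c) ∂(prodBernoulli w) ≤ ∫ ω, F (openCluster ω a) ∂(prodBernoulli w)) →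
      (∫ ω, F (openCluster ω c) ∂(prodBernoulli w) ≤ ∫ ω, F (openCluster ω k) ∂(prodBernoulli w)) →
      (prodBernoulli w).real
          (({ω : BondConfig (Fin n) | ∀ a ∈ (↑X' : Set (Fin n)), ¬ (openGraph ω).Reachable k a} ∩ openConn k o) ∩
            {ω : BondConfig (Fin n) | openCluster ω k ∈ 𝓗}) *
          (∫ ω in ⋃ a ∈ X', openConn k a, (F (openCluster ω k) - F (openCluster ω c)) ∂(prodBernoulli w)) ≤
        (prodBernoulli w).real {ω : BondConfig (Fin n) | ∀ a ∈ (↑X' : Set (Fin n)), ¬ (openGraph ω).Reachable k a} *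
          ∫ ω in {ω : BondConfig (Fin n) | openCluster ω o ∈ 𝓗} ∩ ⋃ a ∈ X', openConn o a,
            (F (openCluster ω o) - F (openCluster ω c)) ∂(prodBernoulli w))
    (A : Finset (Fin n)) (o c : Fin n) (hoA : o ∉ A) (hcA : c ∈ A)
    (hcmin : ∀ a ∈ A, ∫ ω, F (openCluster ω c) ∂(prodBernoulli w) ≤ ∫ ω, F (openCluster ω a) ∂(prodBernoulli w)) :
    0 ≤ ∫ ω in {ω : BondConfig (Fin n) | openCluster ω o ∈ 𝓗} ∩ ⋃ a' ∈ A, openConn o a',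
        (F (openCluster ω o) - F (openCluster ω c)) ∂(prodBernoulli w) := by
  classical
  set μ := prodBernoulli w with hμ
  have hmeas : ∀ S : Set (BondConfig (Fin n)), MeasurableSet S := fun _ => MeasurableSet.of_discrete
  have hint : ∀ (g : BondConfig (Fin n) → ℝ), Integrable g μ := fun g => Integrable.of_finite
  set Ho : Set (BondConfig (Fin n)) := {ω : BondConfig (Fin n) | openCluster ω o ∈ 𝓗} with hHo
  have main : ∀ (X : Finset (Fin n)), X ⊆ A → c ∈ X →
      0 ≤ ∫ ω in Ho ∩ ⋃ a' ∈ X, openConn o a', (F (openCluster ω o) - F (openCluster ω c)) ∂μ := by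
    intro X hXA hcX
    have hoX : o ∉ X := fun h => hoA (hXA h)
    rcases (X.erase c).eq_empty_or_nonempty with h0 | hne
    · have hXc : X = {c} := by rw [← Finset.insert_erase hcX, h0]; rfl
      rw [hXc]
      have hU : (⋃ a ∈ ({c} : Finset (Fin n)), (openConn o a : Set (BondConfig (Fin n)))) = openConn o c := by ext ω; simp
      rw [hU, setIntegral_congr_fun (hmeas _) (g := fun _ => (0 : ℝ)) (fun ω hω => by
        show F (openCluster ω o) - F (openCluster ω c) = 0
        rw [openCluster_eq_of_reach (show (openGraph ω).Reachable o c from hω.2), sub_self])]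
      simp
    obtain ⟨k, hk⟩ := hne
    have hkc : k ≠ c := (Finset.mem_erase.1 hk).1
    have hkX : k ∈ X := (Finset.mem_erase.1 hk).2
    set X' : Finset (Fin n) := X.erase k with hX'
    have hX'X : ∀ a ∈ X', a ∈ X := fun a ha => Finset.mem_of_mem_erase ha
    have hkX' : k ∉ X' := Finset.notMem_erase k X
    have hcX' : c ∈ X' := Finset.mem_erase.2 ⟨hkc.symm, hcX⟩
    have hko : o ≠ k := fun h => hoX (h ▸ hkX)
    have hoX' : o ∉ X' := fun h => hoX (hX'X o h)
    have hmk : ∫ ω, F (openCluster ω c) ∂μ ≤ ∫ ω, F (openCluster ω k) ∂μ := hcmin k (hXA hkX)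
    set Dk : Set (BondConfig (Fin n)) := {ω : BondConfig (Fin n) | ∀ a ∈ (↑X' : Set (Fin n)), ¬ (openGraph ω).Reachable k a}
      with hDk
    set Hk : Set (BondConfig (Fin n)) := {ω : BondConfig (Fin n) | openCluster ω k ∈ 𝓗} with hHk
    set gk : BondConfig (Fin n) → ℝ := fun ω => F (openCluster ω k) - F (openCluster ω c) with hgk
    set Gk : Set (Sym2 (Fin n)) → ℝ := fun K => F {z | z = k ∨ ∃ e ∈ K, z ∈ e} -
      ∫ η, F (openCluster (η \ BHK2006.barOf {k} K) c) ∂μ with hGk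
    have hGk_mono : Monotone Gk := CovTau.monotone_projFun w c k F hF
    set Δo : ℝ := ∫ ω in Ho ∩ ⋃ a' ∈ X', openConn o a', (F (openCluster ω o) - F (openCluster ω c)) ∂μ with hΔo
    set Δk : ℝ := ∫ ω in ⋃ a' ∈ X', openConn k a', (F (openCluster ω k) - F (openCluster ω c)) ∂μ with hΔk
    set Tko : ℝ := ∫ ω in (Dk ∩ openConn k o) ∩ Hk, gk ω ∂μ with hTko
    set J : ℝ := ∫ ω in Dk, gk ω ∂μ with hJ
    set M : ℝ := μ.real Dk with hM
    set E : ℝ := μ.real ((Dk ∩ openConn k o) ∩ Hk) with hE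
    -- peel under the event
    have hpeel : ∫ ω in Ho ∩ ⋃ a' ∈ X, openConn o a', (F (openCluster ω o) - F (openCluster ω c)) ∂μ = Δo + Tko := by
      rw [hΔo, hTko, hgk]
      exact refined_erase_add w X F 𝓗 c k o hkX
    -- the family of edge clusters describing the peeled piece, and the tower identities
    set 𝓗K : Set (Set (Sym2 (Fin n))) := {K | {z : Fin n | z = k ∨ ∃ e ∈ K, z ∈ e} ∈ 𝓗} with h𝓗K
    have h𝓗K_upper : IsUpperSet 𝓗K := by
      intro K K' hKK' hK
      refine h𝓗 ?_ hK
      intro z hz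
      rcases hz with h | ⟨e, he, hze⟩
      · exact Or.inl h
      · exact Or.inr ⟨e, hKK' he, hze⟩
    have hHk_eq : Hk = {ω : BondConfig (Fin n) | openEdgeCluster ω k ∈ 𝓗K} := by
      ext ω
      simp only [hHk, h𝓗K, mem_setOf_eq, openCluster_eq_span ω k]
    have hDk_S : (Dk ∩ openConn k o) ∩ Hk =
        {ω : BondConfig (Fin n) | ¬ (openGraph ω).Reachable k c} ∩
          {ω | openEdgeCluster ω k ∈ {K : Set (Sym2 (Fin n)) |
            (∀ a ∈ X', a ≠ c → ¬ (a = k ∨ ∃ e ∈ K, a ∈ e)) ∧ (o = k ∨ ∃ e ∈ K, o ∈ e) ∧ K ∈ 𝓗K}} := by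
      ext ω
      simp only [mem_inter_iff, hDk, hHk_eq, mem_setOf_eq, Finset.mem_coe]
      constructor
      · rintro ⟨⟨h1, h2⟩, h3⟩
        refine ⟨h1 c hcX', fun a ha _ => ?_, (reachable_iff_exists_mem_openEdgeCluster ω k o).1 h2, h3⟩
        rw [← reachable_iff_exists_mem_openEdgeCluster]; exact h1 a ha
      · rintro ⟨h1, h2, h3, h4⟩
        refine ⟨⟨fun a ha => ?_, (reachable_iff_exists_mem_openEdgeCluster ω k o).2 h3⟩, h4⟩
        by_cases hac : a = c
        · rw [hac]; exact h1
        · rw [reachable_iff_exists_mem_openEdgeCluster]; exact h2 a ha hac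
    have hDk_0 : Dk = {ω : BondConfig (Fin n) | ¬ (openGraph ω).Reachable k c} ∩
          {ω | openEdgeCluster ω k ∈ {K : Set (Sym2 (Fin n)) | ∀ a ∈ X', a ≠ c → ¬ (a = k ∨ ∃ e ∈ K, a ∈ e)}} := by
      ext ω
      simp only [mem_inter_iff, hDk, mem_setOf_eq, Finset.mem_coe]
      constructor
      · intro h1
        refine ⟨h1 c hcX', fun a ha _ => ?_⟩
        rw [← reachable_iff_exists_mem_openEdgeCluster]; exact h1 a ha
      · rintro ⟨h1, h2⟩ a ha
        by_cases hac : a = c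
        · rw [hac]; exact h1
        · rw [reachable_iff_exists_mem_openEdgeCluster]; exact h2 a ha hac
    have towO : Tko = ∫ ω in (Dk ∩ openConn k o) ∩ Hk, Gk (openEdgeCluster ω k) ∂μ := by
      simp only [hTko, hgk]; rw [hDk_S]; exact CovTau.setIntegral_sub_eq_projFun w c k F _
    have tow0 : J = ∫ ω in Dk, Gk (openEdgeCluster ω k) ∂μ := by
      simp only [hJ, hgk]; rw [hDk_0]; exact CovTau.setIntegral_sub_eq_projFun w c k F _
    have hJtot : J = ((∫ ω, F (openCluster ω k) ∂μ) - ∫ ω, F (openCluster ω c) ∂μ) - Δk := by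
      have h1 := integral_add_compl (hmeas Dk) (hint gk)
      have hDkc : Dkᶜ = ⋃ a' ∈ X', (openConn k a' : Set (BondConfig (Fin n))) := by
        ext ω
        rw [mem_iUnion_openConn, mem_compl_iff, hDk]
        simp only [mem_setOf_eq, Finset.mem_coe, not_forall, not_not, exists_prop]
      have h2 : ∫ ω in Dkᶜ, gk ω ∂μ = Δk := by rw [hDkc]
      have h3 : ∫ ω, gk ω ∂μ = (∫ ω, F (openCluster ω k) ∂μ) - ∫ ω, F (openCluster ω c) ∂μ := by
        rw [hgk, integral_sub (hint _) (hint _)]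
      rw [hJ]; linarith
    -- one-cluster positive association for `C_k` given `k ↮ X'`, with the monotone indicator `1{k↔o}·1{C k ∈ 𝓗}`
    set 𝒰 : Set (Set (Sym2 (Fin n))) := connFamily k o ∩ 𝓗K with h𝒰
    have h𝒰_upper : IsUpperSet 𝒰 := (isUpperSet_connFamily k o).inter h𝓗K_upper
    have hG : Monotone (𝒰.indicator (1 : Set (Sym2 (Fin n)) → ℝ)) := monotone_indicator_one_of_isUpperSet h𝒰_upper
    have hPA := BHK2006_clusterConditionalPositiveAssociation_holds (Fin n) w k (↑X' : Set (Fin n)) Gk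
      (𝒰.indicator 1) hGk_mono hG (by exact_mod_cast hkX')
    have hset : {ω : BondConfig (Fin n) | openEdgeCluster ω k ∈ 𝒰} = openConn k o ∩ Hk := by
      ext ω
      simp only [h𝒰, mem_setOf_eq, mem_inter_iff, hHk_eq]
      rw [openConn_eq_setOf_connFamily]
      rfl
    have hind : (fun ω : BondConfig (Fin n) => 𝒰.indicator (1 : Set (Sym2 (Fin n)) → ℝ) (openEdgeCluster ω k)) =
        (openConn k o ∩ Hk : Set (BondConfig (Fin n))).indicator 1 := by
      rw [indicator_comp_openEdgeCluster 𝒰 k, hset]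
    have hI1 : ∫ ω in Dk, 𝒰.indicator (1 : Set (Sym2 (Fin n)) → ℝ) (openEdgeCluster ω k) ∂μ = E := by
      rw [show (fun ω => 𝒰.indicator (1 : Set (Sym2 (Fin n)) → ℝ) (openEdgeCluster ω k)) =
        (openConn k o ∩ Hk : Set (BondConfig (Fin n))).indicator 1 from hind, setIntegral_indicator_one_eq, hE,
        inter_assoc]
    have hI2 : ∫ ω in Dk, Gk (openEdgeCluster ω k) * 𝒰.indicator (1 : Set (Sym2 (Fin n)) → ℝ) (openEdgeCluster ω k) ∂μ =
        ∫ ω in (Dk ∩ openConn k o) ∩ Hk, Gk (openEdgeCluster ω k) ∂μ := by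
      have e : ∀ ω : BondConfig (Fin n), Gk (openEdgeCluster ω k) *
          𝒰.indicator (1 : Set (Sym2 (Fin n)) → ℝ) (openEdgeCluster ω k) =
          Gk (openEdgeCluster ω k) * (openConn k o ∩ Hk : Set (BondConfig (Fin n))).indicator (1 : BondConfig (Fin n) → ℝ) ω :=
        fun ω => congrArg (fun t => Gk (openEdgeCluster ω k) * t) (congrFun hind ω)
      simp_rw [e]
      rw [setIntegral_mul_indicator_one μ Dk (openConn k o ∩ Hk) _, inter_assoc]
    have hC : J * E ≤ M * Tko := by
      have h := hPA
      rw [hI1, hI2, ← tow0, ← towO] at h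
      rw [hM]
      linarith [h]
    -- the refined two-observer margin (hypothesis)
    have hpm' : E * Δk ≤ M * Δo := by
      have h := hII o k c X' hko hoX' hkX' hcX' (fun a ha => hcmin a (hXA (hX'X a ha))) hmk
      rw [hE, hΔk, hM, hΔo]
      exact h
    have hMnn : 0 ≤ M := measureReal_nonneg
    have hE0 : 0 ≤ E := measureReal_nonneg
    have hmk' : 0 ≤ (∫ ω, F (openCluster ω k) ∂μ) - ∫ ω, F (openCluster ω c) ∂μ := by linarith [hmk]
    have hfin : 0 ≤ M * (Δo + Tko) := by
      have hJE : J * E = ((∫ ω, F (openCluster ω k) ∂μ) - ∫ ω, F (openCluster ω c) ∂μ) * E - Δk * E := by rw [hJtot]; ring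
      nlinarith [hC, hpm', hJE, mul_nonneg hmk' hE0]
    rw [hpeel]
    -- if `M = 0` the peeled piece and (by `hII` with `M = 0`) ... we avoid division: use positivity of `M` from non-degeneracy
    have hMpos : 0 < M := by
      refine prodBernoulli_real_pos_of_nonempty hw ⟨∅, ?_⟩
      intro a ha h
      rw [HullPort.reachable_empty_iff] at h
      exact hkX' (h ▸ (Finset.mem_coe.1 ha))
    exact le_of_mul_le_mul_left (by rw [mul_zero]; exact hfin) hMpos
  exact main A (subset_refl A) hcA

/-- **The event-refined Conjecture 4 (designated form) for EVERY relay set, from (II)_𝓗**: for every `A ≠ ∅` and `o`, some `a ∈ A`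
(any relay of least mean, or `o` itself if `o ∈ A`) has `∫_{{C o ∈ 𝓗} ∩ {o↔A}} F(C a) ≤ ∫_{{C o ∈ 𝓗} ∩ {o↔A}} F(C o)`.  With `𝓗 = univ`
the hypothesis is `PreFKGSurplus.preMargin_nonneg_of_csh` at `D = []` (cleared of denominators) and the conclusion is `kn_conj4_of_csh`.
[cite: KozmaNitzan2024, Conj. 4 (p. 32)] -/
theorem conj4_refined_of_twoObserver (w : Sym2 (Fin n) → unitInterval) (hw : ∀ e, 0 < w e ∧ w e < 1)
    (𝓗 : Set (Set (Fin n))) (h𝓗 : IsUpperSet 𝓗)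
    (F : Set (Fin n) → ℝ) (hF : ∀ S T : Set (Fin n), S ⊆ T → F S ≤ F T)
    (hII : ∀ (o k c : Fin n) (X' : Finset (Fin n)), o ≠ k → o ∉ X' → k ∉ X' → c ∈ X' →
      (∀ a ∈ X', ∫ ω, F (openCluster ω c) ∂(prodBernoulli w) ≤ ∫ ω, F (openCluster ω a) ∂(prodBernoulli w)) →
      (∫ ω, F (openCluster ω c) ∂(prodBernoulli w) ≤ ∫ ω, F (openCluster ω k) ∂(prodBernoulli w)) →
      (prodBernoulli w).real
          (({ω : BondConfig (Fin n) | ∀ a ∈ (↑X' : Set (Fin n)), ¬ (openGraph ω).Reachable k a} ∩ openConn k o) ∩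
            {ω : BondConfig (Fin n) | openCluster ω k ∈ 𝓗}) *
          (∫ ω in ⋃ a ∈ X', openConn k a, (F (openCluster ω k) - F (openCluster ω c)) ∂(prodBernoulli w)) ≤
        (prodBernoulli w).real {ω : BondConfig (Fin n) | ∀ a ∈ (↑X' : Set (Fin n)), ¬ (openGraph ω).Reachable k a} *
          ∫ ω in {ω : BondConfig (Fin n) | openCluster ω o ∈ 𝓗} ∩ ⋃ a ∈ X', openConn o a,
            (F (openCluster ω o) - F (openCluster ω c)) ∂(prodBernoulli w))
    (A : Finset (Fin n)) (o : Fin n) (hA : A.Nonempty) :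
    ∃ a ∈ A, ∫ ω in {ω : BondConfig (Fin n) | openCluster ω o ∈ 𝓗} ∩ ⋃ a' ∈ A, openConn o a',
        F (openCluster ω a) ∂(prodBernoulli w) ≤
      ∫ ω in {ω : BondConfig (Fin n) | openCluster ω o ∈ 𝓗} ∩ ⋃ a' ∈ A, openConn o a',
        F (openCluster ω o) ∂(prodBernoulli w) := by
  classical
  have hint : ∀ (g : BondConfig (Fin n) → ℝ), Integrable g (prodBernoulli w) := fun g => Integrable.of_finite
  by_cases hoA : o ∈ A
  · exact ⟨o, hoA, le_rfl⟩
  obtain ⟨c, hcA, hcmin⟩ := Finset.exists_min_image A (fun u => ∫ ω, F (openCluster ω u) ∂(prodBernoulli w)) hA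
  refine ⟨c, hcA, ?_⟩
  have hΔ := refined_margin_nonneg_of_twoObserver w hw 𝓗 h𝓗 F hF hII A o c hoA hcA hcmin
  rw [integral_sub (hint _).integrableOn (hint _).integrableOn] at hΔ
  linarith

/-- **Question 7 refined by an increasing cluster event, from (II)_𝓗** (the case `F = 1{b ∈ ·}`): for `E = {C o ∈ 𝓗} ∩ {o ↔ A}`,
`o ∉ A`, and `c ∈ A` with `μ(c ↔ b) ≤ μ(a ↔ b)` for all `a ∈ A`:  `μ({c ↔ b} ∩ E) ≤ μ({o ↔ b} ∩ E)`.  For `o` a vertex attached only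
to `A` and `𝓗` generated by patterns of the pairs at `o` this is the line's (UT4) for the up-set `𝓗` (memo §5).
[cite: KozmaNitzan2024, Question 7 (p. 36)] -/
theorem question7_refined_of_twoObserver (w : Sym2 (Fin n) → unitInterval) (hw : ∀ e, 0 < w e ∧ w e < 1)
    (𝓗 : Set (Set (Fin n))) (h𝓗 : IsUpperSet 𝓗) (b : Fin n)
    (hII : ∀ (o k c : Fin n) (X' : Finset (Fin n)), o ≠ k → o ∉ X' → k ∉ X' → c ∈ X' →
      (∀ a ∈ X', (prodBernoulli w).real (openConn c b) ≤ (prodBernoulli w).real (openConn a b)) →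
      ((prodBernoulli w).real (openConn c b) ≤ (prodBernoulli w).real (openConn k b)) →
      (prodBernoulli w).real
          (({ω : BondConfig (Fin n) | ∀ a ∈ (↑X' : Set (Fin n)), ¬ (openGraph ω).Reachable k a} ∩ openConn k o) ∩
            {ω : BondConfig (Fin n) | openCluster ω k ∈ 𝓗}) *
          ((prodBernoulli w).real (openConn k b ∩ ⋃ a ∈ X', openConn k a) -
            (prodBernoulli w).real (openConn c b ∩ ⋃ a ∈ X', openConn k a)) ≤
        (prodBernoulli w).real {ω : BondConfig (Fin n) | ∀ a ∈ (↑X' : Set (Fin n)), ¬ (openGraph ω).Reachable k a} *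
          ((prodBernoulli w).real (openConn o b ∩ ({ω : BondConfig (Fin n) | openCluster ω o ∈ 𝓗} ∩ ⋃ a ∈ X', openConn o a)) -
            (prodBernoulli w).real (openConn c b ∩ ({ω : BondConfig (Fin n) | openCluster ω o ∈ 𝓗} ∩ ⋃ a ∈ X', openConn o a))))
    (A : Finset (Fin n)) (o c : Fin n) (hoA : o ∉ A) (hcA : c ∈ A)
    (hcmin : ∀ a ∈ A, (prodBernoulli w).real (openConn c b) ≤ (prodBernoulli w).real (openConn a b)) :
    (prodBernoulli w).real (openConn c b ∩ ({ω : BondConfig (Fin n) | openCluster ω o ∈ 𝓗} ∩ ⋃ a ∈ A, openConn o a)) ≤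
      (prodBernoulli w).real (openConn o b ∩ ({ω : BondConfig (Fin n) | openCluster ω o ∈ 𝓗} ∩ ⋃ a ∈ A, openConn o a)) := by
  classical
  set μ := prodBernoulli w with hμ
  set F : Set (Fin n) → ℝ := fun S => if b ∈ S then (1 : ℝ) else 0 with hFdef
  have hF : ∀ S T : Set (Fin n), S ⊆ T → F S ≤ F T := by
    intro S T hST
    by_cases hb : b ∈ S
    · simp [hFdef, hb, hST hb]
    · by_cases hb' : b ∈ T <;> simp [hFdef, hb, hb']
  have hI : ∀ (x : Fin n) (S : Set (BondConfig (Fin n))), ∫ ω in S, F (openCluster ω x) ∂μ = μ.real (openConn x b ∩ S) := by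
    intro x S
    have hfun : (fun ω : BondConfig (Fin n) => F (openCluster ω x)) = (openConn x b : Set (BondConfig (Fin n))).indicator 1 := by
      funext ω
      by_cases h : (openGraph ω).Reachable x b
      · have hb : b ∈ openCluster ω x := h
        have hω : ω ∈ (openConn x b : Set (BondConfig (Fin n))) := h
        rw [indicator_of_mem hω]; simp [hFdef, hb]
      · have hb : b ∉ openCluster ω x := h
        have hω : ω ∉ (openConn x b : Set (BondConfig (Fin n))) := h
        rw [indicator_of_notMem hω]; simp [hFdef, hb]
    rw [hfun, setIntegral_indicator_one_eq, inter_comm]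
  have hI0 : ∀ x : Fin n, ∫ ω, F (openCluster ω x) ∂μ = μ.real (openConn x b) := by
    intro x
    have h := hI x univ
    rwa [Measure.restrict_univ, inter_univ] at h
  have hsub : ∀ (x y : Fin n) (S : Set (BondConfig (Fin n))),
      ∫ ω in S, (F (openCluster ω x) - F (openCluster ω y)) ∂μ = μ.real (openConn x b ∩ S) - μ.real (openConn y b ∩ S) := by
    intro x y S
    rw [integral_sub (Integrable.of_finite).integrableOn (Integrable.of_finite).integrableOn, hI, hI]
  have hII' : ∀ (o k c : Fin n) (X' : Finset (Fin n)), o ≠ k → o ∉ X' → k ∉ X' → c ∈ X' →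
      (∀ a ∈ X', ∫ ω, F (openCluster ω c) ∂μ ≤ ∫ ω, F (openCluster ω a) ∂μ) →
      (∫ ω, F (openCluster ω c) ∂μ ≤ ∫ ω, F (openCluster ω k) ∂μ) →
      μ.real (({ω : BondConfig (Fin n) | ∀ a ∈ (↑X' : Set (Fin n)), ¬ (openGraph ω).Reachable k a} ∩ openConn k o) ∩
            {ω : BondConfig (Fin n) | openCluster ω k ∈ 𝓗}) *
          (∫ ω in ⋃ a ∈ X', openConn k a, (F (openCluster ω k) - F (openCluster ω c)) ∂μ) ≤
        μ.real {ω : BondConfig (Fin n) | ∀ a ∈ (↑X' : Set (Fin n)), ¬ (openGraph ω).Reachable k a} *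
          ∫ ω in {ω : BondConfig (Fin n) | openCluster ω o ∈ 𝓗} ∩ ⋃ a ∈ X', openConn o a,
            (F (openCluster ω o) - F (openCluster ω c)) ∂μ := by
    intro o' k c' X' hok hoX hkX hcX hmin hmk
    rw [hsub, hsub]
    refine hII o' k c' X' hok hoX hkX hcX (fun a ha => ?_) ?_
    · have h := hmin a ha; rwa [hI0, hI0] at h
    · rwa [hI0, hI0] at hmk
  have hΔ := refined_margin_nonneg_of_twoObserver w hw 𝓗 h𝓗 F hF hII' A o c hoA hcA
    (fun a ha => by rw [hI0, hI0]; exact hcmin a ha)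
  rw [hsub] at hΔ
  linarith

end RefinedPreFKG

end Summit.CriticalPhenomena.PercolationContinuityZ3.Theorems

end
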